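import Summits.KontsevichZagierPeriods.KontsevichZagierPeriods.Theses.HermiteRigidity
import Summits.KontsevichZagierPeriods.KontsevichZagierPeriods.Theorems.HermiteRigidityGenusTwoCycleTransferPencil
import Summits.KontsevichZagierPeriods.KontsevichZagierPeriods.Theorems.HermiteRigidityGenusTwoCycleTransferSemialgebraicInvFunOn
import Summits.KontsevichZagierPeriods.KontsevichZagierPeriods.Theorems.HermiteRigidityGenusTwoCycleTransferPushforwardDimOne

/-!
# `GenusTwoCycleTransfer` (crux stmt-KontsevichZagierPeriods-3408, route HermiteRigidity)

Closing file of the line `separating-pencil-trace`. On the genus-2 curve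
`y² = f(x) = x(x−1)(x−2)(x−3)(x−5)` the three integrals `∫_J dx/√f`, `J = (0,1), (2,3), (5,∞)`, are
pushed forward to the half-line `(0,∞)` by the explicit strictly increasing `ℚ`-semialgebraic
bijections `Φ(x) = √(N(x)/D(x))`, `N = x(x−2)(x−5)`, `D = (x−1)(x−3)` — one instance of
Kontsevich–Zagier's rule (2) (`KZ.changeOfVariablesRel`) each, supplied by the generic
one-dimensional push-forward `stub_pushforwardDimOne` together with `stub_semialgebraicInvFunOn`.
The fibre of `Φ` over `l > 0` is cut out by the interlacing cubic pencil `c_l = N − l²D` (one simple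
root in each oval), the push-forward integrands are `ψᵢ(l) = 2/|∂ₓc_l(Xᵢ(l))|`, and
`ψ₁ − ψ₂ + ψ₃ ≡ 0` on `(0,∞)` is partial fractions for a monic cubic with three simple roots (the
trace of `dx/y` under the separating `g¹₃` `y/((x−1)(x−3))` of the curve); one instance of rule (1b)
(`KZ.integrandAddRel`) then closes the derivation. All pencil-specific real algebra/analysis
(signs, `Φ′ = (W/(2ND))·Φ` with `W = (x²−4x+5)² + (x−1)² + 4 > 0`, injectivity, interlacing,
semialgebraicity, the weight `(1/√f)/|Φ′| = 2/|∂ₓc_l|`, the trace identity) is in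
`HermiteRigidityGenusTwoCycleTransferPencil.lean`; as there, every expression is written out
explicitly (no definitions or notations are introduced).

`GenusTwoCycleTransfer_proof` concludes the route declaration
`Summit.KontsevichZagierPeriods.KontsevichZagierPeriods.Theses.HermiteRigidity.GenusTwoCycleTransfer`
by name.

References: M. Kontsevich, D. Zagier, *Periods* (2001), §1.2 rules (1), (2); J. Bochnak,
M. Coste, M.-F. Roy, *Real Algebraic Geometry* (1998), §2.2.
-/

noncomputable section

open Set MeasureTheory
open Literature.NumberTheory.Transcendental Literature.ModelTheory.ExponentialFields

namespace Summit.KontsevichZagierPeriods.HermiteRigidity.GenusTwoCycleTransfer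

/-! ### One oval: the rule-2 push-forward to `(0, ∞)` -/

/-- **One oval.** For a representation `r = [{p | p 0 ∈ J}, 1/√f]` on an open interval `J` where
`N, D ≠ 0`, `N/D > 0`, and every level `l > 0` of `Φ = √(N/D)` is cut out by a root of `c_l` in `J`,
the rule-2 push-forward of `r` along `Φ` exists: a representation `s` with domain `(0, ∞)` whose
integrand at `l` is `2/|∂ₓc_l(x)|` at the root `x ∈ J` of `c_l`, with
`[r] − [s] ∈ KZ.changeOfVariablesRel`. (`Φ` is injective on `J` since `(N/D)′ = W/D² > 0`; its
inverse on the image is semialgebraic by `stub_semialgebraicInvFunOn`; the push-forward is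
`stub_pushforwardDimOne`; the weight `(1/√f)/|Φ′| = 2/|∂ₓc_l|` is `weight_root`.)
[cite: KontsevichZagier2001, §1.2 rule (2)] -/
theorem oval_pushforward {J : Set ℝ} (hJ : Convex ℝ J) (hJo : IsOpen J) (r : KZ.IntegralRep 1)
    (hd : r.domain = {p | p 0 ∈ J})
    (hi : EqOn r.integrand
      (fun p => 1 / Real.sqrt (p 0 * (p 0 - 1) * (p 0 - 2) * (p 0 - 3) * (p 0 - 5))) r.domain)
    (hND : ∀ x ∈ J, x * (x - 2) * (x - 5) ≠ 0 ∧ (x - 1) * (x - 3) ≠ 0 ∧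
      0 < x * (x - 2) * (x - 5) / ((x - 1) * (x - 3)))
    (hsurj : ∀ l, 0 < l → ∃ x ∈ J, x * (x - 2) * (x - 5) - l ^ 2 * ((x - 1) * (x - 3)) = 0) :
    ∃ s : KZ.IntegralRep 1, s.domain = {q | 0 < q 0} ∧
      (∀ l x, 0 < l → x ∈ J → x * (x - 2) * (x - 5) - l ^ 2 * ((x - 1) * (x - 3)) = 0 →
        3 * x ^ 2 - 14 * x + 10 - l ^ 2 * (2 * x - 4) ≠ 0 →
        s.integrand (fun _ => l) = 2 / |3 * x ^ 2 - 14 * x + 10 - l ^ 2 * (2 * x - 4)|) ∧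
      KZ.of r - KZ.of s ∈ KZ.changeOfVariablesRel := by
  have hσ : IsSemialgebraic ℚ r.domain := r.isSemialgebraic_domain
  have hmem : ∀ p : Fin 1 → ℝ, p ∈ r.domain ↔ p 0 ∈ J := fun p => by rw [hd]; rfl
  have hNσ : ∀ p ∈ r.domain, p 0 * (p 0 - 2) * (p 0 - 5) ≠ 0 := fun p hp =>
    (hND _ ((hmem p).1 hp)).1
  have hDσ : ∀ p ∈ r.domain, (p 0 - 1) * (p 0 - 3) ≠ 0 := fun p hp =>
    (hND _ ((hmem p).1 hp)).2.1
  -- Φ, Φ′ are ℚ-semialgebraic on the domain, Φ′ is the derivative of Φ and never vanishes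
  have hφ := phi_semialgebraic hσ hDσ
  have hφ' := phi'_semialgebraic hσ hNσ hDσ
  have hder := fun p (hp : p ∈ r.domain) =>
    hasDerivAt_phi (p 0) (hNσ p hp) (hDσ p hp) (hND _ ((hmem p).1 hp)).2.2
  have hne := fun p (hp : p ∈ r.domain) =>
    phi'_ne_zero (p 0) (hNσ p hp) (hDσ p hp) (hND _ ((hmem p).1 hp)).2.2
  -- Φ is injective on J, so `p ↦ (Φ (p 0))` is injective on the domain with semialgebraic inverse
  have hinj : InjOn (fun x : ℝ => Real.sqrt (x * (x - 2) * (x - 5) / ((x - 1) * (x - 3)))) J :=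
    phi_injOn hJ hJo (fun x hx => (hND x hx).2.1) (fun x hx => (hND x hx).2.2)
  set Φ : (Fin 1 → ℝ) → (Fin 1 → ℝ) :=
    fun p _ => Real.sqrt (p 0 * (p 0 - 2) * (p 0 - 5) / ((p 0 - 1) * (p 0 - 3))) with hΦ_def
  have hΦsa : IsSemialgebraicMapOn ℚ r.domain Φ := IsSemialgebraicMapOn.of_forall hσ fun _ => hφ
  have hΦinj : InjOn Φ r.domain := by
    intro p hp p' hp' h
    have h0 := hinj ((hmem p).1 hp) ((hmem p').1 hp') (congrFun h 0)
    funext i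
    rw [Fin.fin_one_eq_zero i]
    exact h0
  have hG : IsSemialgebraicMapOn ℚ (Φ '' r.domain) (Function.invFunOn Φ r.domain) :=
    stub_semialgebraicInvFunOn hΦsa hΦinj
  have hGφ : ∀ p ∈ r.domain, Function.invFunOn Φ r.domain (Φ p) = p := fun p hp =>
    hΦinj.leftInvOn_invFunOn hp
  -- the rule-2 push-forward
  obtain ⟨s, hsd, hsi, hrel⟩ := stub_pushforwardDimOne r
    (fun y => Real.sqrt (y * (y - 2) * (y - 5) / ((y - 1) * (y - 3))))
    (fun y => ((y ^ 2 - 4 * y + 5) ^ 2 + (y - 1) ^ 2 + 4) / (2 * (y * (y - 2) * (y - 5)) *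
      ((y - 1) * (y - 3))) * Real.sqrt (y * (y - 2) * (y - 5) / ((y - 1) * (y - 3))))
    (Function.invFunOn Φ r.domain) hφ hφ' hder hne hG hGφ
  -- its domain is (0, ∞)
  have hpos : ∀ x ∈ J, 0 < Real.sqrt (x * (x - 2) * (x - 5) / ((x - 1) * (x - 3))) :=
    fun x hx => Real.sqrt_pos.mpr (hND x hx).2.2
  have hsurj' : ∀ l, 0 < l → ∃ x ∈ J,
      Real.sqrt (x * (x - 2) * (x - 5) / ((x - 1) * (x - 3))) = l := fun l hl => by
    obtain ⟨x, hx, hc⟩ := hsurj l hl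
    exact ⟨x, hx, phi_root l x hl (hND x hx).2.1 hc⟩
  refine ⟨s, hsd.trans (image_phi_eq hd hpos hsurj'), fun l x hl hx hc hdc => ?_, hrel⟩
  -- and its integrand at `l = Φ x` is the rule-2 weight `(1/√f(x))/|Φ′(x)| = 2/|∂ₓc_l(x)|`
  have hp : (fun _ : Fin 1 => x) ∈ r.domain := (hmem _).2 hx
  have h1 := hsi _ hp
  have h2 : (fun _ : Fin 1 => Real.sqrt (x * (x - 2) * (x - 5) / ((x - 1) * (x - 3)))) =
      fun _ => l :=
    funext fun _ => phi_root l x hl (hND x hx).2.1 hc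
  simp only [h2] at h1
  rw [h1, hi hp]
  exact weight_root l x hl (hND x hx).2.1 hc hdc

/-! ### Composition: the crux -/

/-- **The crux `GenusTwoCycleTransfer`** (stmt-KontsevichZagierPeriods-3408): on the genus-2 curve
`y² = f(x) = x(x−1)(x−2)(x−3)(x−5)`, for any integral representations `r₁, r₂, r₃` of
`∫₀¹ dx/√f`, `∫₂³ dx/√f`, `∫₅^∞ dx/√f` on the ovals, `[r₁] − [r₂] + [r₃] ∈ KZ.relations`.
Derivation: three rule-2 push-forwards to `(0, ∞)` (`oval_pushforward` on `(0,1)`, `(2,3)`,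
`(5,∞)`) and one integrand-additivity move (rule 1b), the push-forward integrands satisfying
`ψ₂ = ψ₁ + ψ₃` pointwise on `(0,∞)` by the trace identity at the three interlacing roots of the
pencil cubic. [cite: KontsevichZagier2001, §1.2 rules (1), (2)] -/
theorem GenusTwoCycleTransfer_proof :
    Summit.KontsevichZagierPeriods.KontsevichZagierPeriods.Theses.HermiteRigidity.GenusTwoCycleTransfer := by
  unfold Summit.KontsevichZagierPeriods.KontsevichZagierPeriods.Theses.HermiteRigidity.GenusTwoCycleTransfer
  intro f r₁ r₂ r₃ h1d h1i h2d h2i h3d h3i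
  -- the three ovals: N, D ≠ 0 and N/D > 0 there
  have hND₁ : ∀ x ∈ Ioo (0:ℝ) 1, x * (x - 2) * (x - 5) ≠ 0 ∧ (x - 1) * (x - 3) ≠ 0 ∧
      0 < x * (x - 2) * (x - 5) / ((x - 1) * (x - 3)) := fun x hx =>
    ⟨(signs_Ioo01 x hx).1.ne', (signs_Ioo01 x hx).2.ne',
      div_pos (signs_Ioo01 x hx).1 (signs_Ioo01 x hx).2⟩
  have hND₂ : ∀ x ∈ Ioo (2:ℝ) 3, x * (x - 2) * (x - 5) ≠ 0 ∧ (x - 1) * (x - 3) ≠ 0 ∧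
      0 < x * (x - 2) * (x - 5) / ((x - 1) * (x - 3)) := fun x hx =>
    ⟨(signs_Ioo23 x hx).1.ne, (signs_Ioo23 x hx).2.ne,
      div_pos_of_neg_of_neg (signs_Ioo23 x hx).1 (signs_Ioo23 x hx).2⟩
  have hND₃ : ∀ x ∈ Ioi (5:ℝ), x * (x - 2) * (x - 5) ≠ 0 ∧ (x - 1) * (x - 3) ≠ 0 ∧
      0 < x * (x - 2) * (x - 5) / ((x - 1) * (x - 3)) := fun x hx =>
    ⟨(signs_Ioi5 x hx).1.ne', (signs_Ioi5 x hx).2.ne',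
      div_pos (signs_Ioi5 x hx).1 (signs_Ioi5 x hx).2⟩
  -- three rule-2 moves
  obtain ⟨s₁, hs₁d, hs₁i, hs₁r⟩ := oval_pushforward (convex_Ioo 0 1) isOpen_Ioo r₁ h1d
    (by rw [h1d]; exact h1i) hND₁ exists_root_Ioo01
  obtain ⟨s₂, hs₂d, hs₂i, hs₂r⟩ := oval_pushforward (convex_Ioo 2 3) isOpen_Ioo r₂ h2d
    (by rw [h2d]; exact h2i) hND₂ exists_root_Ioo23
  obtain ⟨s₃, hs₃d, hs₃i, hs₃r⟩ := oval_pushforward (convex_Ioi 5) isOpen_Ioi r₃ h3d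
    (by rw [h3d]; exact h3i) hND₃ exists_root_Ioi5
  -- the trace identity: ψ₂ = ψ₁ + ψ₃ on (0, ∞)
  have key : EqOn s₂.integrand (s₁.integrand + s₃.integrand) s₂.domain := by
    intro q hq
    rw [hs₂d] at hq
    set l : ℝ := q 0 with hl_def
    have hl : 0 < l := hq
    obtain ⟨x₁, hx₁, hc₁⟩ := exists_root_Ioo01 l hl
    obtain ⟨x₂, hx₂, hc₂⟩ := exists_root_Ioo23 l hl
    obtain ⟨x₃, hx₃, hc₃⟩ := exists_root_Ioi5 l hl
    have h₁₂ : x₁ < x₂ := (hx₁.2.trans one_lt_two).trans hx₂.1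
    have hx₃' : 5 < x₃ := hx₃
    have h₂₃ : x₂ < x₃ := by linarith [hx₂.2]
    have h₁₃ : x₁ < x₃ := h₁₂.trans h₂₃
    obtain ⟨hd₁, hd₂, hd₃⟩ := dc_at_roots l x₁ x₂ x₃ h₁₂ h₂₃ hc₁ hc₂ hc₃
    have hne₁ : 3 * x₁ ^ 2 - 14 * x₁ + 10 - l ^ 2 * (2 * x₁ - 4) ≠ 0 := by
      rw [hd₁]; exact mul_ne_zero (sub_ne_zero.mpr h₁₂.ne) (sub_ne_zero.mpr h₁₃.ne)
    have hne₂ : 3 * x₂ ^ 2 - 14 * x₂ + 10 - l ^ 2 * (2 * x₂ - 4) ≠ 0 := by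
      rw [hd₂]; exact mul_ne_zero (sub_ne_zero.mpr h₁₂.ne') (sub_ne_zero.mpr h₂₃.ne)
    have hne₃ : 3 * x₃ ^ 2 - 14 * x₃ + 10 - l ^ 2 * (2 * x₃ - 4) ≠ 0 := by
      rw [hd₃]; exact mul_ne_zero (sub_ne_zero.mpr h₁₃.ne') (sub_ne_zero.mpr h₂₃.ne')
    have hq' : q = fun _ => l := funext fun i => congrArg q (Fin.fin_one_eq_zero i)
    rw [hq', Pi.add_apply, hs₁i l x₁ hl hx₁ hc₁ hne₁, hs₂i l x₂ hl hx₂ hc₂ hne₂,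
      hs₃i l x₃ hl hx₃ hc₃ hne₃, hd₁, hd₂, hd₃]
    exact trace_identity x₁ x₂ x₃ h₁₂ h₂₃
  -- one rule-1b move
  have hadd : KZ.of s₂ - KZ.of s₁ - KZ.of s₃ ∈ KZ.integrandAddRel :=
    ⟨1, s₂, s₁, s₃, by rw [hs₁d, hs₂d], by rw [hs₃d, hs₂d], key, rfl⟩
  have h₁ := KZ.changeOfVariablesRel_subset_relations hs₁r
  have h₂ := KZ.changeOfVariablesRel_subset_relations hs₂r
  have h₃ := KZ.changeOfVariablesRel_subset_relations hs₃r
  have h₄ := KZ.integrandAddRel_subset_relations hadd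
  have : KZ.of r₁ - KZ.of r₂ + KZ.of r₃ = (KZ.of r₁ - KZ.of s₁) - (KZ.of r₂ - KZ.of s₂) +
      (KZ.of r₃ - KZ.of s₃) - (KZ.of s₂ - KZ.of s₁ - KZ.of s₃) := by abel
  rw [this]
  exact KZ.relations.sub_mem (KZ.relations.add_mem (KZ.relations.sub_mem h₁ h₂) h₃) h₄

end Summit.KontsevichZagierPeriods.HermiteRigidity.GenusTwoCycleTransfer

end
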